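import Mathlib.GroupTheory.FiniteAbelian.Duality
import Mathlib.RingTheory.ZMod.Torsion
import Mathlib.Algebra.BigOperators.Ring.Finset
import Mathlib.GroupTheory.OrderOfElement
import HarnessLib

set_option autoImplicit false

/-!
# The minus part of an `𝔽_p[G]`-module is carried by its ODD isotypic components (`G` finite commutative of exponent
# dividing `p − 1`): `#N ≤ ∏_{χ(z) ≠ 1} #N^{ker χ}` (theorem-only; no named fact, no `sorry`)

Topic `GroupTheory/FiniteAbelian` (namespace = path).  THEOREM-ONLY file written by the prover seat `bsd-potss-rkm`
(generation 37, cell `bsd-potss`; `--supports` stmt-BirchSwinnertonDyer-19196 — crux M `ReducibleKatoMember` of the routes K9 /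
K8-t′ of `BirchSwinnertonDyer`; closes nothing).  Consumer: `NumberTheory/NumberFields/ClassGroupMinusPartOddCharacters.lean`
(the minus `p`-torsion of the class group of an abelian CM field is carried by its odd cyclic subfields — Leopoldt–Scholz
reflection in isotypic form) and, up the cyclotomic `ℤ_p`-tower, `IwasawaTheory/ClassicalMuVanishesOddCharacterDescent.lean`.

## The mathematics (Mathlib inputs only)

Let `p` be an odd prime and `G` a finite commutative group with `exp G ∣ p − 1`.  Then every character of `G` is
`𝔽_p`-valued: `Ĝ := Hom(G, 𝔽_pˣ)` has `#Ĝ = #G` and separates the points of `G` (Mathlib's duality for finite abelian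
groups, `CommGroup.exists_apply_ne_one_of_hasEnoughRootsOfUnity` / `CommGroup.card_monoidHom_of_hasEnoughRootsOfUnity`,
with `ZMod p` having enough `(p − 1)`-th roots of unity), whence the orthogonality `∑_χ χ(g) = #G·[g = 1]` in `𝔽_p`
and `p ∤ #G`.  Let `G` act on a commutative group `A` (`ρ : G → Aut A`, multiplicative notation as for Mathlib's
`ClassGroup`) and let `N ≤ A` be a finite `G`-stable subgroup of exponent `p` on which a fixed `z ∈ G` acts by INVERSION
(`N` is a "minus part").  The twisted traces `T_χ(m) := ∏_{g ∈ G} (g·m)^{χ(g⁻¹)}` (`= #G · ε_χ m` for the idempotent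
`ε_χ ∈ 𝔽_p[G]`) satisfy `h·T_χ(m) = T_χ(m)^{χ(h)}` — so `T_χ(m) ∈ N^{ker χ}` —, `∏_χ T_χ(m) = m^{#G}`, and `T_χ(m) = 1` when
`χ(z) = 1` (`z` both fixes and inverts it, `p` odd).  Since `m ↦ m^{#G}` is onto `N` (Bezout), `N = ∏_{χ(z) ≠ 1} T_χ(N)`:
  **`#N ≤ ∏_{χ ∈ Ĝ, χ(z) ≠ 1} #{m ∈ N : (ker χ)·m = m}`** (`card_le_prod_card_fixed_of_oddCharacters`).

## What is NOT here (honest scope)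

No statement for `p = 2` or for `exp G ∤ p − 1` (non-`𝔽_p`-rational characters); no exact isotypic decomposition
`N ≅ ⊕_χ ε_χ N` is recorded, only the counting inequality the consumer needs.

## References

* L. C. Washington, *Introduction to Cyclotomic Fields*, 2nd ed., GTM 83 (1997), §6.3 (the idempotents `ε_χ` of `ℤ_p[G]`
  for `p ∤ #G`, orthogonality relations) and §10.2 (even/odd components). [Washington1997]
* Mathlib `GroupTheory/FiniteAbelian/Duality`, `RingTheory/ZMod/Torsion`.
-/

namespace Literature.GroupTheory.FiniteAbelian

section GroupAlgebra

variable {G : Type*} [CommGroup G] [Fintype G] {A : Type*} [CommGroup A] {p : ℕ} [hp : Fact p.Prime]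

/-- **`p ∤ #G` when `exp G ∣ p − 1`** (Cauchy: an element of order `p` would give `p ∣ exp G`). [folklore] -/
private theorem not_dvd_natCard_of_exponent_dvd (hG : Monoid.exponent G ∣ p - 1) : ¬ p ∣ Nat.card G := by
  intro h
  rw [Nat.card_eq_fintype_card] at h
  obtain ⟨g, hg⟩ := exists_prime_orderOf_dvd_card p h
  have h1 : orderOf g ∣ p - 1 := (Monoid.order_dvd_exponent g).trans hG
  rw [hg] at h1
  have h2 := Nat.le_of_dvd (Nat.sub_pos_of_lt hp.out.one_lt) h1
  have h3 := hp.out.one_lt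
  omega

/-- **Orthogonality of `𝔽_pˣ`-valued characters**: for a finite commutative group `G` with `exp G ∣ p − 1` and `g ≠ 1`,
`∑_{χ : G → 𝔽_pˣ} χ(g) = 0` in `𝔽_p` (a character `ψ` with `ψ(g) ≠ 1` exists by Mathlib's duality for finite abelian groups —
`𝔽_p` has enough `(p−1)`-th roots of unity — and `∑_χ χ(g) = ψ(g)·∑_χ χ(g)`). [cite: Washington1997, §6.3 (orthogonality relations behind the idempotents `ε_χ`)] -/
theorem sum_monoidHom_apply_eq_zero [Fintype (G →* (ZMod p)ˣ)] (hG : Monoid.exponent G ∣ p - 1) {g : G}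
    (hg : g ≠ 1) : ∑ χ : G →* (ZMod p)ˣ, ((χ g : (ZMod p)ˣ) : ZMod p) = 0 := by
  haveI : NeZero (p - 1) := ⟨Nat.sub_ne_zero_of_lt hp.out.one_lt⟩
  haveI : HasEnoughRootsOfUnity (ZMod p) (Monoid.exponent G) := HasEnoughRootsOfUnity.of_dvd (ZMod p) hG
  obtain ⟨ψ, hψ⟩ := CommGroup.exists_apply_ne_one_of_hasEnoughRootsOfUnity G (ZMod p) hg
  set S := ∑ χ : G →* (ZMod p)ˣ, ((χ g : (ZMod p)ˣ) : ZMod p) with hS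
  have h1 : S = ((ψ g : (ZMod p)ˣ) : ZMod p) * S := by
    rw [hS, Finset.mul_sum]
    refine (Fintype.sum_equiv (Equiv.mulLeft ψ) _ _ fun χ => ?_).symm
    simp only [Equiv.coe_mulLeft, MonoidHom.mul_apply, Units.val_mul]
  have h2 : (((ψ g : (ZMod p)ˣ) : ZMod p) - 1) * S = 0 := by rw [sub_mul, one_mul, ← h1, sub_self]
  rcases mul_eq_zero.mp h2 with h | h
  · exact absurd (Units.val_eq_one.mp (sub_eq_zero.mp h)) hψ
  · exact h

/-- **`#Hom(G, 𝔽_pˣ) = #G`** for a finite commutative group with `exp G ∣ p − 1` (Mathlib's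
`CommGroup.card_monoidHom_of_hasEnoughRootsOfUnity`). [cite: Washington1997, §6.3] -/
theorem card_monoidHom_eq_natCard [Fintype (G →* (ZMod p)ˣ)] (hG : Monoid.exponent G ∣ p - 1) :
    Fintype.card (G →* (ZMod p)ˣ) = Nat.card G := by
  haveI : NeZero (p - 1) := ⟨Nat.sub_ne_zero_of_lt hp.out.one_lt⟩
  haveI : HasEnoughRootsOfUnity (ZMod p) (Monoid.exponent G) := HasEnoughRootsOfUnity.of_dvd (ZMod p) hG
  rw [← Nat.card_eq_fintype_card]
  exact CommGroup.card_monoidHom_of_hasEnoughRootsOfUnity G (ZMod p)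

/-- Exponent arithmetic on an element of order dividing `p`: `x^{(ab) mod p} = (x^{a})^{b}`. [folklore] -/
private theorem pow_val_mul {x : A} (hx : x ^ p = 1) (a b : ZMod p) : x ^ (a * b).val = (x ^ a.val) ^ b.val := by
  rw [← pow_mul, ZMod.val_mul, ← pow_eq_pow_mod _ hx]

/-- **The twisted trace `T_χ(m) = ∏_g (g·m)^{χ(g⁻¹)}` transforms by `χ`**: `h·T_χ(m) = T_χ(m)^{χ(h)}` (for `m` whose
conjugates are killed by `p`). [cite: Washington1997, §6.3 (`σ ε_χ = χ(σ) ε_χ`)] -/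
theorem apply_prod_pow_val_eq (ρ : G →* MulAut A) (χ : G →* (ZMod p)ˣ) {m : A} (hm : ∀ g, (ρ g m) ^ p = 1)
    (h : G) :
    ρ h (∏ g, ρ g m ^ ((χ g⁻¹ : (ZMod p)ˣ) : ZMod p).val) =
      (∏ g, ρ g m ^ ((χ g⁻¹ : (ZMod p)ˣ) : ZMod p).val) ^ ((χ h : (ZMod p)ˣ) : ZMod p).val := by
  rw [map_prod, ← Finset.prod_pow]
  have e1 : ∀ g, ρ h (ρ g m ^ ((χ g⁻¹ : (ZMod p)ˣ) : ZMod p).val) =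
      ρ (h * g) m ^ ((χ g⁻¹ : (ZMod p)ˣ) : ZMod p).val := fun g => by
    rw [map_pow, map_mul, MulAut.mul_apply]
  simp_rw [e1]
  refine Fintype.prod_equiv (Equiv.mulLeft h) _ _ fun g => ?_
  simp only [Equiv.coe_mulLeft]
  rw [← pow_val_mul (hm (h * g)), ← Units.val_mul, ← map_mul, mul_inv_rev, inv_mul_cancel_right]

/-- **`∏_χ T_χ(m) = m^{#G}`** (orthogonality: the exponent of `g·m` is `∑_χ χ(g⁻¹) ≡ #G·[g = 1] (mod p)`).
[cite: Washington1997, §6.3 (`∑_χ ε_χ = 1`)] -/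
theorem prod_prod_pow_val_eq [Fintype (G →* (ZMod p)ˣ)] (hG : Monoid.exponent G ∣ p - 1) (ρ : G →* MulAut A)
    {m : A} (hm : ∀ g, (ρ g m) ^ p = 1) :
    ∏ χ : G →* (ZMod p)ˣ, ∏ g, ρ g m ^ ((χ g⁻¹ : (ZMod p)ˣ) : ZMod p).val = m ^ Nat.card G := by
  rw [Finset.prod_comm]
  simp_rw [Finset.prod_pow_eq_pow_sum]
  rw [Fintype.prod_eq_single 1]
  · rw [map_one, MulAut.one_apply, ← card_monoidHom_eq_natCard hG, ← Finset.card_univ, Finset.card_eq_sum_ones]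
    refine congrArg _ (Finset.sum_congr rfl fun χ _ => ?_)
    rw [inv_one, map_one, Units.val_one, ZMod.val_one]
  · intro g hg
    have hsum : (∑ χ : G →* (ZMod p)ˣ, ((χ g⁻¹ : (ZMod p)ˣ) : ZMod p).val) % p = 0 := by
      have h0 := sum_monoidHom_apply_eq_zero hG (inv_ne_one.mpr hg)
      apply Nat.mod_eq_zero_of_dvd
      rw [← ZMod.natCast_eq_zero_iff, Nat.cast_sum]
      simpa only [ZMod.natCast_zmod_val] using h0
    rw [pow_eq_pow_mod _ (hm g), hsum, pow_zero]

/-- **§1 MAIN: the minus part of an `𝔽_p[G]`-module is carried by its ODD isotypic components.**  `G` a finite commutative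
group with `exp G ∣ p − 1` (`p` an odd prime) acting on a commutative group `A`, `N ≤ A` a `G`-stable finite subgroup of
exponent `p` on which `z ∈ G` acts by inversion.  Then
  **`#N ≤ ∏_{χ : G → 𝔽_pˣ, χ(z) ≠ 1} #{m ∈ N : (ker χ)·m = m}`**:
every `m ∈ N` is `∏_{χ odd} T_χ(m')` with `m'^{#G} = m` (`p ∤ #G`, Bezout), `T_χ(m') ∈ N^{ker χ}`, and the even `T_χ` vanish
(`z` both fixes and inverts them).  With `𝔽_p[G] = ∏_χ 𝔽_p ε_χ` this is `N = ⊕_{χ odd} ε_χ N`, `ε_χ N ⊆ N^{ker χ}`.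
[cite: Washington1997, §6.3 (decomposition by the idempotents `ε_χ`, `p ∤ #G`) and §10.2 (even/odd components under `J`)] -/
theorem card_le_prod_card_fixed_of_oddCharacters [Finite A] [Fintype (G →* (ZMod p)ˣ)] (hp2 : p ≠ 2)
    (hG : Monoid.exponent G ∣ p - 1) (ρ : G →* MulAut A) (N : Subgroup A)
    (hN : ∀ g, ∀ m ∈ N, ρ g m ∈ N) (hNp : ∀ m ∈ N, m ^ p = 1) {z : G} (hz : ∀ m ∈ N, ρ z m = m⁻¹) :
    Nat.card N ≤ ∏ χ : {χ : G →* (ZMod p)ˣ // χ z ≠ 1},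
      Nat.card {m : A // m ∈ N ∧ ∀ g ∈ (χ : G →* (ZMod p)ˣ).ker, ρ g m = m} := by
  classical
  -- the twisted traces
  set T : (G →* (ZMod p)ˣ) → A → A := fun χ m => ∏ g, ρ g m ^ ((χ g⁻¹ : (ZMod p)ˣ) : ZMod p).val with hT
  have hmp : ∀ m ∈ N, ∀ g, (ρ g m) ^ p = 1 := fun m hm g => by rw [← map_pow, hNp m hm, map_one]
  have hTN : ∀ χ, ∀ m ∈ N, T χ m ∈ N := fun χ m hm =>
    Subgroup.prod_mem N fun g _ => N.pow_mem (hN g m hm) _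
  have hTρ : ∀ χ, ∀ m ∈ N, ∀ h, ρ h (T χ m) = (T χ m) ^ ((χ h : (ZMod p)ˣ) : ZMod p).val :=
    fun χ m hm h => apply_prod_pow_val_eq ρ χ (hmp m hm) h
  have hTfix : ∀ χ, ∀ m ∈ N, ∀ g ∈ (χ : G →* (ZMod p)ˣ).ker, ρ g (T χ m) = T χ m := by
    intro χ m hm g hg
    rw [hTρ χ m hm g, MonoidHom.mem_ker.mp hg, Units.val_one, ZMod.val_one, pow_one]
  -- even characters contribute nothing
  have hTeven : ∀ χ : G →* (ZMod p)ˣ, χ z = 1 → ∀ m ∈ N, T χ m = 1 := by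
    intro χ hχ m hm
    have h1 : ρ z (T χ m) = T χ m := hTfix χ m hm z (by rw [MonoidHom.mem_ker, hχ])
    have h2 : ρ z (T χ m) = (T χ m)⁻¹ := hz _ (hTN χ m hm)
    have hsq : (T χ m) ^ 2 = 1 := by
      rw [pow_two]
      exact mul_eq_one_iff_eq_inv.mpr (h1.symm.trans h2)
    have hg : Nat.gcd 2 p = 1 :=
      Nat.Coprime.gcd_eq_one (Nat.coprime_two_left.mpr (hp.out.odd_of_ne_two hp2))
    rw [← pow_one (T χ m), ← hg]
    exact pow_gcd_eq_one.mpr ⟨hsq, hNp _ (hTN χ m hm)⟩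
  -- `m ^ #G = ∏_{χ odd} T_χ m`
  have hprod : ∀ m ∈ N, m ^ Nat.card G = ∏ χ : {χ : G →* (ZMod p)ˣ // χ z ≠ 1}, T χ m := by
    intro m hm
    rw [← prod_prod_pow_val_eq hG ρ (hmp m hm),
      ← Fintype.prod_subtype_mul_prod_subtype (fun χ : G →* (ZMod p)ˣ => χ z ≠ 1),
      Fintype.prod_eq_one (fun χ : {χ : G →* (ZMod p)ˣ // ¬ χ z ≠ 1} => T χ m)
        fun χ => hTeven χ (not_ne_iff.mp χ.2) m hm, mul_one]
  -- `m ↦ m ^ #G` is onto `N` (Bezout, `p ∤ #G`)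
  set d := Nat.card G with hd
  have hdp : Nat.Coprime d p :=
    Nat.coprime_comm.mp ((Nat.Prime.coprime_iff_not_dvd hp.out).mpr (not_dvd_natCard_of_exponent_dvd hG))
  have hbez : (d : ℤ) * Nat.gcdA d p + (p : ℤ) * Nat.gcdB d p = 1 := by
    rw [← Nat.gcd_eq_gcd_ab d p, Nat.Coprime.gcd_eq_one hdp]; rfl
  have hroot : ∀ m ∈ N, (m ^ Nat.gcdA d p) ^ d = m := by
    intro m hm
    rw [← zpow_natCast, ← zpow_mul, mul_comm]
    calc m ^ ((d : ℤ) * Nat.gcdA d p) = m ^ ((d : ℤ) * Nat.gcdA d p) * m ^ ((p : ℤ) * Nat.gcdB d p) := by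
          rw [zpow_mul m p, zpow_natCast, hNp m hm, one_zpow, mul_one]
      _ = m := by rw [← zpow_add, hbez, zpow_one]
  -- the product map from the odd fixed parts is onto
  let Φ : (∀ χ : {χ : G →* (ZMod p)ˣ // χ z ≠ 1},
      {m : A // m ∈ N ∧ ∀ g ∈ (χ : G →* (ZMod p)ˣ).ker, ρ g m = m}) → N :=
    fun x => ⟨∏ χ, (x χ : A), Subgroup.prod_mem N fun χ _ => (x χ).2.1⟩
  have hΦ : Function.Surjective Φ := by
    rintro ⟨m, hm⟩
    have hm' : m ^ Nat.gcdA d p ∈ N := N.zpow_mem hm _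
    refine ⟨fun χ => ⟨T χ (m ^ Nat.gcdA d p), hTN χ _ hm', hTfix χ _ hm'⟩, Subtype.ext ?_⟩
    change ∏ χ : {χ : G →* (ZMod p)ˣ // χ z ≠ 1}, T χ (m ^ Nat.gcdA d p) = m
    rw [← hprod _ hm', hroot m hm]
  haveI : ∀ χ : {χ : G →* (ZMod p)ˣ // χ z ≠ 1},
      Finite {m : A // m ∈ N ∧ ∀ g ∈ (χ : G →* (ZMod p)ˣ).ker, ρ g m = m} := fun χ =>
    Finite.of_injective (fun x => (x : A)) Subtype.val_injective
  calc Nat.card N ≤ Nat.card (∀ χ : {χ : G →* (ZMod p)ˣ // χ z ≠ 1},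
        {m : A // m ∈ N ∧ ∀ g ∈ (χ : G →* (ZMod p)ˣ).ker, ρ g m = m}) :=
        Nat.card_le_card_of_surjective Φ hΦ
    _ = _ := Nat.card_pi

end GroupAlgebra

end Literature.GroupTheory.FiniteAbelian
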